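import Literature.NumberTheory.DiophantineGeometry.MinimalDiscriminantBaseChangeCongruence
import Summits.BirchSwinnertonDyer.BirchSwinnertonDyer.Theses.ByReductionTypeAtTwo
import HarnessLib

/-!
# K4 crux `AdditiveRankZeroAtTwo` (item 19098), WIDTH-LEVER lane B — the road «semistable base change
# to the field of good reduction + Kato over that field + norm descent»: a KERNEL obstruction on the
# field of good reduction above `2`

Cell `bsd-2adic`, seat `bsd-2adic-addL2x` GEN 12. HONEST FRAMING: types-the-object-of; closes nothing;
BSD is not proved by any of this. Theorems only (no `def`, no named fact, no instance).

The director's road for the crux needs, for each additive-at-`2` curve `E/ℚ`, a number field `K` and a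
place `w ∣ 2` of `K` at which `E_K` has GOOD reduction, over which an Euler-system divisibility is
available; Kato's Euler system (Astérisque 295 §§ 8–17) lives over ABELIAN extensions of `ℚ`. GEN 0 of
this lane recorded as prose (VERDICT-19098-addL2x-GEN0 §2 (L1)) that for semistability defect
`Φ ⊇ C₃` no abelian field can be a field of good reduction at `2`. This file makes the
curve-theoretic half of that obstruction a kernel theorem, for every prime-`2` place of every number
field, from the Literature congruence `12 ∣ e(w∣2)·ord₂(Δ) ` at a place of good reduction
(`Literature.NumberTheory.DiophantineGeometry.MinimalDiscriminantBaseChangeCongruence`, Silverman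
*AEC* VII.1 Remark 1.1 / VII.5 Prop. 5.1 (a), 5.4):

* `twelve_dvd_ramificationIdx_mul_padicValRat_Δ_of_hasGoodReductionAt_two` — if `E_K` is good at a
  place `w ∣ 2` then `12 ∣ e(w∣2)·ord₂(Δ(W))` for ANY equation `W` of `E` (so `e(w∣2)` is divisible by
  `12 / gcd(12, ord₂ Δ_min)`);
* `not_hasGoodReductionAt_two_of_not_three_dvd` — `3 ∤ ord₂(Δ(W))` and `3 ∤ e(w∣2)` ⟹ `E_K` is NOT
  good at `w`;
* `not_hasGoodReductionAt_two_of_odd_of_not_four_dvd` — `ord₂(Δ(W))` odd and `4 ∤ e(w∣2)` ⟹ not good.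

The remaining half — every finite abelian extension of `ℚ₂` has ramification index a power of `2`
(local Kronecker–Weber, `ℚ₂^ab = ℚ₂^nr(ζ_{2^∞})`) — is print and is NOT asserted here; with it, the
first obstruction says: no abelian number field is a field of good reduction above `2` for a curve with
`3 ∤ ord₂(Δ_min)`.

CENSUS (instrument reading, lane A kit j239581 `HOME/memos/ROUTE-L2-files/phi_census.tsv`, re-read by
this seat 2026-08-28): on the 1 382 defect-`≥ 3` classes `3 ∤ ord₂(Δ_min)` holds on exactly the
1 175 classes with `Φ ∈ {C₃ (454: ord₂Δ_min ∈ {4,8}), C₆ (147: {4,8,10,14}), SL₂(𝔽₃) (574: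
{4,7,8,10,11,13,14,16,17})}` and fails on all `Q₈` (189: {6,9,12,15}) and `C₄` (18: {9,15}) classes;
`ord₂(Δ_min)` is odd on 181 `SL₂(𝔽₃)` + 53 `Q₈` + all 18 `C₄` classes (there `4 ∣ e(w∣2)` is forced),
and `12 ∣ e(w∣2)` is forced on the 181 `SL₂(𝔽₃)` classes with `ord₂(Δ_min) ∈ {7,11,13,17}`.
-/

noncomputable section

set_option autoImplicit false
set_option linter.dupNamespace false

open scoped Classical
open IsDedekindDomain NumberField WeierstrassCurve

namespace Summit.BirchSwinnertonDyer.BirchSwinnertonDyer.Theorems.AddGoodReductionField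

/-! ## The place of `ℤ` under a place of `K` above `2` -/

/-- A finite place `w` of a number field `K` with `2 ∈ w` lies over the place `(2)` of `ℤ`, i.e. over
the place `v` of `ℤ` with `natGenerator v = 2` (`(2)` is maximal in `ℤ` and `w ∩ ℤ` is a proper ideal
containing it). [folklore] -/
theorem liesOver_of_two_mem {K : Type*} [Field K] [NumberField K] (w : HeightOneSpectrum (𝓞 K))
    (hw : (2 : 𝓞 K) ∈ w.asIdeal) (v : HeightOneSpectrum ℤ)
    (hv : Rat.HeightOneSpectrum.natGenerator v = 2) : w.asIdeal.LiesOver v.asIdeal := by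
  refine ⟨?_⟩
  rw [WeierstrassCurve.asIdeal_eq_span_natGenerator v, hv]
  have hmax : (Ideal.span {((2 : ℕ) : ℤ)}).IsMaximal :=
    PrincipalIdealRing.isMaximal_of_irreducible (by exact_mod_cast Int.prime_two.irreducible)
  refine (hmax.eq_of_le ?_ ?_)
  · exact Ideal.IsPrime.ne_top (Ideal.IsPrime.under ℤ w.asIdeal)
  · rw [Ideal.span_le, Set.singleton_subset_iff]
    change algebraMap ℤ (𝓞 K) ((2 : ℕ) : ℤ) ∈ w.asIdeal
    simpa using hw

/-- There is a place of `ℤ` with rational prime `2` below it. [folklore] -/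
theorem exists_place_two : ∃ v : HeightOneSpectrum ℤ, Rat.HeightOneSpectrum.natGenerator v = 2 :=
  ⟨(Rat.HeightOneSpectrum.primesEquiv (R := ℤ)).symm ⟨2, Nat.prime_two⟩,
    Literature.NumberTheory.EllipticCurves.Rat.natGenerator_primesEquiv_symm ⟨2, Nat.prime_two⟩⟩

/-- The ramification index `e(w∣2)` of a place `w ∋ 2` of `K`, computed from the place `v` of `ℤ`
below it, is the ramification index over the ideal `(2) ⊂ ℤ`. [folklore] -/
theorem ramificationIdx'_eq_of_natGenerator_eq_two {K : Type*} [Field K] [NumberField K]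
    (w : HeightOneSpectrum (𝓞 K)) (v : HeightOneSpectrum ℤ)
    (hv : Rat.HeightOneSpectrum.natGenerator v = 2) :
    v.asIdeal.ramificationIdx' w.asIdeal = (Ideal.span {(2 : ℤ)}).ramificationIdx' w.asIdeal := by
  rw [WeierstrassCurve.asIdeal_eq_span_natGenerator v, hv]; rfl

/-! ## The obstruction at `2` -/

variable (W : WeierstrassCurve ℚ) [W.IsElliptic] (K : Type*) [Field K] [NumberField K]
  (w : HeightOneSpectrum (𝓞 K))

/-- **Good reduction above `2` forces `12 ∣ e(w∣2)·ord₂(Δ)`.** For an elliptic curve over `ℚ` given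
by ANY equation `W` (for a globally minimal `W`, `ord₂(Δ(W)) = ord₂(Δ_min)`), a number field `K` and a
finite place `w` of `K` containing `2`: if the base change `W_K` has good reduction at `w`, then
`12 ∣ e(w∣2)·ord₂(Δ(W))`. Equivalently `12/gcd(12, ord₂ Δ) ∣ e(w∣2)`: the road «base change to a field
of good reduction above 2» must pass through a place of ramification index divisible by `3`
(`ord₂ Δ_min ∈ {4,8,16}`: 1 175 − … classes), by `6` (`∈ {10,14}`), by `12` (`∈ {7,11,13,17}`), by `4`
(`∈ {9,15}`), by `2` (`= 6`). [cite: SilvermanAEC2009, VII.1 Remark 1.1; VII.5 Prop. 5.1 (a), Prop. 5.4] -/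
theorem twelve_dvd_ramificationIdx_mul_padicValRat_Δ_of_hasGoodReductionAt_two
    (hw : (2 : 𝓞 K) ∈ w.asIdeal) (h : (W.baseChange K).HasGoodReductionAt w) :
    (12 : ℤ) ∣ ((Ideal.span {(2 : ℤ)}).ramificationIdx' w.asIdeal : ℤ) * padicValRat 2 W.Δ := by
  obtain ⟨v, hv⟩ := exists_place_two
  haveI := liesOver_of_two_mem w hw v hv
  have h12 := W.twelve_dvd_ramificationIdx_mul_padicValRat_Δ_of_hasGoodReductionAt v K w h
  rwa [ramificationIdx'_eq_of_natGenerator_eq_two w v hv, hv] at h12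

/-- **No field of good reduction above `2` with `3 ∤ e(w∣2)` when `3 ∤ ord₂(Δ)`** (the 1 175 classes
`Φ ∈ {C₃, C₆, SL₂(𝔽₃)}` of the defect-`≥ 3` block): for an elliptic curve over `ℚ` with
`3 ∤ ord₂(Δ(W))` (any equation `W`), every number field `K` and every finite place `w ∋ 2` of `K` with
`3 ∤ e(w∣2)`, the base change `W_K` does NOT have good reduction at `w`. By local Kronecker–Weber
(print, not asserted here) every place above `2` of an ABELIAN number field has `e(w∣2)` a power of
`2`, so no abelian number field — the habitat of Kato's Euler system — is a field of good reduction
above `2` for these curves. [cite: SilvermanAEC2009, VII.1 Remark 1.1; VII.5 Prop. 5.1 (a), Prop. 5.4] -/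
theorem not_hasGoodReductionAt_two_of_not_three_dvd (hW : ¬ (3 : ℤ) ∣ padicValRat 2 W.Δ)
    (hw : (2 : 𝓞 K) ∈ w.asIdeal) (he : ¬ 3 ∣ (Ideal.span {(2 : ℤ)}).ramificationIdx' w.asIdeal) :
    ¬ (W.baseChange K).HasGoodReductionAt w := by
  obtain ⟨v, hv⟩ := exists_place_two
  haveI := liesOver_of_two_mem w hw v hv
  have hW' : ¬ (3 : ℤ) ∣ padicValRat (Rat.HeightOneSpectrum.natGenerator v) W.Δ := by rwa [hv]
  have he' : ¬ 3 ∣ v.asIdeal.ramificationIdx' w.asIdeal := by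
    rwa [ramificationIdx'_eq_of_natGenerator_eq_two w v hv]
  exact W.not_hasGoodReductionAt_baseChange_of_not_three_dvd_padicValRat_Δ v K w hW' he'

/-- **No field of good reduction above `2` with `4 ∤ e(w∣2)` when `ord₂(Δ)` is odd** (181 `SL₂(𝔽₃)` +
53 `Q₈` + all 18 `C₄` classes of the block): for an elliptic curve over `ℚ` with `ord₂(Δ(W))` odd
(any equation `W`), every number field `K` and every finite place `w ∋ 2` with `4 ∤ e(w∣2)`, the base
change `W_K` does NOT have good reduction at `w`. [cite: SilvermanAEC2009, VII.1 Remark 1.1; VII.5 Prop. 5.1 (a), Prop. 5.4] -/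
theorem not_hasGoodReductionAt_two_of_odd_of_not_four_dvd (hW : Odd (padicValRat 2 W.Δ))
    (hw : (2 : 𝓞 K) ∈ w.asIdeal) (he : ¬ 4 ∣ (Ideal.span {(2 : ℤ)}).ramificationIdx' w.asIdeal) :
    ¬ (W.baseChange K).HasGoodReductionAt w := by
  obtain ⟨v, hv⟩ := exists_place_two
  haveI := liesOver_of_two_mem w hw v hv
  have hW' : Odd (padicValRat (Rat.HeightOneSpectrum.natGenerator v) W.Δ) := by rwa [hv]
  have he' : ¬ 4 ∣ v.asIdeal.ramificationIdx' w.asIdeal := by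
    rwa [ramificationIdx'_eq_of_natGenerator_eq_two w v hv]
  exact W.not_hasGoodReductionAt_baseChange_of_odd_padicValRat_Δ_of_not_four_dvd v K w hW' he'

/-! ## The obstruction as an index statement: `12 / gcd(12, ord₂ Δ) ∣ e(w∣2)` -/

/-- Arithmetic: `12 ∣ e·n` forces `12 / gcd(12, n) ∣ e`. [folklore] -/
private theorem div_gcd_dvd_of_twelve_dvd_mul {e n : ℕ} (h : 12 ∣ e * n) : 12 / Nat.gcd 12 n ∣ e := by
  set g := Nat.gcd 12 n with hg
  have hg0 : 0 < g := Nat.gcd_pos_of_pos_left _ (by norm_num)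
  have hcop : Nat.Coprime (12 / g) (n / g) := Nat.coprime_div_gcd_div_gcd hg0
  have h12 : 12 = 12 / g * g := (Nat.div_mul_cancel (Nat.gcd_dvd_left 12 n)).symm
  have hn : n = n / g * g := (Nat.div_mul_cancel (Nat.gcd_dvd_right 12 n)).symm
  have h' : 12 / g * g ∣ e * (n / g) * g := by
    rw [← h12, mul_assoc, ← hn]; exact h
  exact hcop.dvd_of_dvd_mul_right (Nat.dvd_of_mul_dvd_mul_right hg0 h')

/-- **The index statement**: if `W_K` (any equation `W` of an elliptic curve over `ℚ`) has good reduction at a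
place `w ∋ 2` of a number field `K`, then `12 / gcd(12, |ord₂ Δ(W)|)` divides the ramification index `e(w∣2)`
— i.e. `3 ∣ e` for `ord₂Δ_min ∈ {4, 8, 16}`, `6 ∣ e` for `{10, 14}`, `12 ∣ e` for `{7, 11, 13, 17}`, `4 ∣ e` for `{9, 15}`,
`2 ∣ e` for `6` (the defect-`≥ 3` census values). [cite: SilvermanAEC2009, VII.1 Remark 1.1; VII.5 Prop. 5.1 (a), Prop. 5.4] -/
theorem div_gcd_dvd_ramificationIdx_of_hasGoodReductionAt_two
    (hw : (2 : 𝓞 K) ∈ w.asIdeal) (h : (W.baseChange K).HasGoodReductionAt w) :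
    12 / Nat.gcd 12 (padicValRat 2 W.Δ).natAbs ∣ (Ideal.span {(2 : ℤ)}).ramificationIdx' w.asIdeal := by
  have h12 := twelve_dvd_ramificationIdx_mul_padicValRat_Δ_of_hasGoodReductionAt_two W K w hw h
  refine div_gcd_dvd_of_twelve_dvd_mul (n := (padicValRat 2 W.Δ).natAbs) ?_
  have h' := Int.natAbs_dvd_natAbs.mpr h12
  rwa [Int.natAbs_mul, Int.natAbs_natCast] at h'

end Summit.BirchSwinnertonDyer.BirchSwinnertonDyer.Theorems.AddGoodReductionField
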